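import Summits.CriticalPhenomena.PercolationContinuityZ3.Theorems.SahiMasterFamilyRigidityAllTerminal

/-!
# Rigidity at every order, terminal configurations II: two active voters with antipodal singleton active sets

Support file of the master-family programme (crux `NoHeavyLowerTail`, stmt-CriticalPhenomena-4575; cell `prim-masterthm`, seat P4,
unit `prim-masterthm-p4-g8`).  Seat document HOME/prim-masterthm-p4/RIGIDITY-ALLK.md §2 STEP m = 2, (iii)–(vi).  Fifth file.

The terminal configuration of the induction with exactly two active voters `j₁, j₂`: the live coordinates split as `S = T₁ ⊔ T₂` (both nonempty),
the active sets are the `S`-cylinders `A_k = V_{j_k} ∩ Q_{j_k} = {ω : ω ∩ S = T_k}`, `A_k ⊆ V₀`, and (from part (b) of the induction hypothesis in the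
`0`-sections) `V₀` is free in every `y ∈ T_k ∖ x` on the face `x ∉ ω`, for each `x ∈ T_k`.  Then:
* `sdiff_mem_of_free`, `supset_of_mem` — stripping free coordinates: every `ω ∈ V₀` missing some `x ∈ T₂` contains `T₁` (else `∅ ∈ V₀`);
* `not_ignores_target` — every live coordinate is essential for `V₀`; `subset_avoid` — `Q_{j₁}` avoids `T₂` (degree count + freeness);
* **`Good.absurd_two`** — contradiction: (GI) at `p ≡ 1/2` reads `u₁z₁q₂ + u₂z₂q₁ = v q₁q₂` with `q_k ≤ z_k`, forcing `u₁ + u₂ ≤ v = μ(V₀)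
  ≤ μ(⊇T₁ ∪ ⊇T₂) = u₁ + u₂ − μ(⊇S) < u₁ + u₂`.
HONEST FRAMING: infrastructure; Sahi `C_k` / Kahn's Conj. 5 / the master theorem remain OPEN.  [this work]
-/

noncomputable section

open scoped Classical

namespace Summit.CriticalPhenomena.PercolationContinuityZ3.Theorems

open Finset Function MvPolynomial MeasureTheory
open Literature.Combinatorics.Sahi2008
open Literature.Probability.LatticeModels (prodBernoulli)
open Literature.Probability.Percolation.BHK2006 (weight)
open Literature.Probability.Percolation.DecisionTree (ind ind_of_mem ind_of_not_mem ind_nonneg)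
open SharedCoordinate (Ignores xInd)
open ExpectationRigidity RigidityR3

namespace RigidityAll

variable {ι : Type*} [Fintype ι] {κ : Type*}
variable {S : Finset ι} {J : Finset κ} {V₀ : Set (Set ι)} {V Q : κ → Set (Set ι)}

/-! ### Stripping free coordinates -/

omit [Fintype ι] in
/-- **If every `y ∈ T` is free for `A` on the face `x ∉ ω`, then removing `T` from a configuration of that face keeps it in `A`.** [this work] -/
theorem sdiff_mem_of_free {A : Set (Set ι)} {x : ι} (T : Finset ι)
    (hT : ∀ y ∈ T, ∀ ω : Set ι, x ∉ ω → (insert y ω ∈ A ↔ ω ∈ A)) {ω : Set ι} (hx : x ∉ ω) (hω : ω ∈ A) :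
    ω \ ↑T ∈ A := by
  induction T using Finset.induction_on with
  | empty => simpa using hω
  | insert a T haT ih =>
    have ih' := ih fun y hy => hT y (mem_insert_of_mem hy)
    have hset : ω \ (↑(insert a T) : Set ι) = (ω \ ↑T) \ {a} := by
      ext i
      simp only [coe_insert, Set.mem_sdiff, Set.mem_insert_iff, mem_coe, Set.mem_singleton_iff]
      tauto
    rw [hset]
    by_cases ha : a ∈ ω \ ↑T
    · have hxa : x ∉ (ω \ ↑T) \ {a} := fun hx' => hx hx'.1.1
      have key := hT a (mem_insert_self a T) ((ω \ ↑T) \ {a}) hxa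
      rw [Set.insert_sdiff_singleton, Set.insert_eq_of_mem ha] at key
      exact key.1 ih'
    · rwa [Set.sdiff_singleton_eq_self ha]

/-- **Every `ω ∈ V₀` on a face `x ∉ ω` (`x ∈ T₂`) contains `T₁`**, when `S ⊆ T₁ ∪ T₂`, `V₀` is free inside each `T_k`-face as stated, and `∅ ∉ V₀`.
(Strip `T₂ ∖ x`, then the dead coordinates, land below `T₁ ∖ z`, strip `T₁ ∖ z`: `∅ ∈ V₀`.) [this work] -/
theorem supset_of_mem (h : Good S J V₀ V Q) {T₁ T₂ : Finset ι} (hcov : ∀ i ∈ S, i ∈ T₁ ∨ i ∈ T₂)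
    (hF₂ : ∀ x ∈ T₂, ∀ y ∈ T₂, y ≠ x → ∀ ω : Set ι, x ∉ ω → (insert y ω ∈ V₀ ↔ ω ∈ V₀))
    (hF₁ : ∀ x ∈ T₁, ∀ y ∈ T₁, y ≠ x → ∀ ω : Set ι, x ∉ ω → (insert y ω ∈ V₀ ↔ ω ∈ V₀))
    (h0 : (∅ : Set ι) ∉ V₀) {x : ι} (hx : x ∈ T₂) {ω : Set ι} (hxω : x ∉ ω) (hω : ω ∈ V₀) : (↑T₁ : Set ι) ⊆ ω := by
  by_contra hnot
  obtain ⟨z, hzT, hzω⟩ := Set.not_subset.1 hnot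
  have hzT' : z ∈ T₁ := mem_coe.1 hzT
  have h1 : ω \ ↑(T₂.erase x) ∈ V₀ :=
    sdiff_mem_of_free (T₂.erase x) (fun y hy => hF₂ x hx y (mem_of_mem_erase hy) (ne_of_mem_erase hy)) hxω hω
  have h2 : (ω \ ↑(T₂.erase x)) \ ↑(univ \ S) ∈ V₀ :=
    sdiff_mem_of_free (x := x) (univ \ S) (fun y hy ω' _ => h.free0 y (mem_sdiff.1 hy).2 ω') (fun h' => hxω h'.1) h1
  have hsub : (ω \ ↑(T₂.erase x)) \ ↑(univ \ S) ⊆ (↑T₁ : Set ι) \ {z} := by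
    intro i hi
    have hiω : i ∈ ω := hi.1.1
    have hiT₂ : i ∉ T₂.erase x := fun h' => hi.1.2 (mem_coe.2 h')
    have hiS : i ∈ S := by
      by_contra hiS
      exact hi.2 (mem_coe.2 (mem_sdiff.2 ⟨mem_univ i, hiS⟩))
    refine ⟨?_, fun hiz => hzω (by rw [Set.mem_singleton_iff.1 hiz] at hiω; exact hiω)⟩
    rcases hcov i hiS with hi1 | hi2
    · exact mem_coe.2 hi1
    · exfalso
      have hix : i = x := by
        by_contra hix
        exact hiT₂ (mem_erase.2 ⟨hix, hi2⟩)
      exact hxω (hix ▸ hiω)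
  have h3 : (↑T₁ : Set ι) \ {z} ∈ V₀ := h.up0 hsub h2
  have h4 : ((↑T₁ : Set ι) \ {z}) \ ↑(T₁.erase z) ∈ V₀ :=
    sdiff_mem_of_free (x := z) (T₁.erase z) (fun y hy => hF₁ z hzT' y (mem_of_mem_erase hy) (ne_of_mem_erase hy))
      (fun h' => h'.2 rfl) h3
  have hempty : ((↑T₁ : Set ι) \ {z}) \ ↑(T₁.erase z) = ∅ :=
    Set.subset_empty_iff.1 fun i hi =>
      (hi.2 (mem_coe.2 (mem_erase.2 ⟨fun h' => hi.1.2 (Set.mem_singleton_iff.2 h'), mem_coe.1 hi.1.1⟩))).elim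
  rw [hempty] at h4
  exact h0 h4

/-! ### One-sided consequences for a voter whose active set is an `S`-cylinder -/

section OneSided

variable {T₁ T₂ : Finset ι} {j : κ}

omit [Fintype ι] in
/-- The cylinder configuration `↑T₁` itself is active. [this work] -/
theorem coe_mem_active (hA : ∀ ω, ω ∈ V j ∩ Q j ↔ ∀ x ∈ S, (x ∈ ω ↔ x ∈ T₁)) : (↑T₁ : Set ι) ∈ V j ∩ Q j :=
  (hA _).2 fun x _ => by simp

omit [Fintype ι] in
/-- **The active set is `{⊇ T₁} ∩ {avoids T₂}`.** [this work] -/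
theorem active_eq_cyl (hdisj : Disjoint T₁ T₂) (hcov : ∀ i ∈ S, i ∈ T₁ ∨ i ∈ T₂) (hT₁ : T₁ ⊆ S) (hT₂ : T₂ ⊆ S)
    (hA : ∀ ω, ω ∈ V j ∩ Q j ↔ ∀ x ∈ S, (x ∈ ω ↔ x ∈ T₁)) :
    V j ∩ Q j = {ω : Set ι | (↑T₁ : Set ι) ⊆ ω} ∩ {ω : Set ι | ∀ i ∈ T₂, i ∉ ω} := by
  ext ω
  rw [hA]
  simp only [Set.mem_inter_iff, Set.mem_setOf_eq]
  constructor
  · intro hω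
    refine ⟨fun i hi => (hω i (hT₁ (mem_coe.1 hi))).2 (mem_coe.1 hi), fun i hi hiω => ?_⟩
    exact disjoint_left.1 hdisj ((hω i (hT₂ hi)).1 hiω) hi
  · rintro ⟨h1, h2⟩ x hxS
    refine ⟨fun hxω => ?_, fun hx1 => h1 (mem_coe.2 hx1)⟩
    rcases hcov x hxS with hx1 | hx2
    · exact hx1
    · exact absurd hxω (h2 x hx2)

/-- **Every `x ∈ T₁` is essential for `V₀`** (else `↑T₁ ∖ x ∈ V₀`, which misses some `x' ∈ T₂` but does not contain `T₁`). [this work] -/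
theorem not_ignores_target (h : Good S J V₀ V Q) (hcov : ∀ i ∈ S, i ∈ T₁ ∨ i ∈ T₂) (hdisj : Disjoint T₁ T₂)
    (hA : ∀ ω, ω ∈ V j ∩ Q j ↔ ∀ x ∈ S, (x ∈ ω ↔ x ∈ T₁)) (hV : V j ∩ Q j ⊆ V₀)
    (hF₂ : ∀ x ∈ T₂, ∀ y ∈ T₂, y ≠ x → ∀ ω : Set ι, x ∉ ω → (insert y ω ∈ V₀ ↔ ω ∈ V₀))
    (hF₁ : ∀ x ∈ T₁, ∀ y ∈ T₁, y ≠ x → ∀ ω : Set ι, x ∉ ω → (insert y ω ∈ V₀ ↔ ω ∈ V₀))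
    (h0 : (∅ : Set ι) ∉ V₀) (hne₂ : T₂.Nonempty) {x : ι} (hx : x ∈ T₁) : ¬ Ignores x (ind V₀) := by
  intro hig
  have hc : (↑T₁ : Set ι) ∈ V₀ := hV (coe_mem_active hA)
  have hmem : (↑T₁ : Set ι) \ {x} ∈ V₀ := by
    have := (forall_iff_of_ignores hig ((↑T₁ : Set ι) \ {x})).1
    rw [Set.insert_sdiff_singleton, Set.insert_eq_of_mem (mem_coe.2 hx)] at this
    exact this hc
  obtain ⟨x', hx'⟩ := hne₂
  have hx'ω : x' ∉ (↑T₁ : Set ι) \ {x} := fun h' => disjoint_left.1 hdisj (mem_coe.1 h'.1) hx'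
  have := supset_of_mem h hcov hF₂ hF₁ h0 hx' hx'ω hmem (mem_coe.2 hx)
  exact this.2 rfl

/-- **`Q_j` avoids `T₂`** when `Q_j` is free on `T₁` (and outside `S`): `θ ∈ Q_j` agrees on `T₂` with `(θ ∩ T₂) ∪ T₁ ∈ V_j ∩ Q_j`, an
`S`-cylinder element, which misses `T₂`. [this work] -/
theorem subset_avoid (h : Good S J V₀ V Q) (hj : j ∈ J) (hcov : ∀ i ∈ S, i ∈ T₁ ∨ i ∈ T₂) (hdisj : Disjoint T₁ T₂) (hT₂ : T₂ ⊆ S)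
    (hA : ∀ ω, ω ∈ V j ∩ Q j ↔ ∀ x ∈ S, (x ∈ ω ↔ x ∈ T₁))
    (hfree : ∀ x ∈ T₁, ∀ ω, insert x ω ∈ Q j ↔ ω ∈ Q j) :
    Q j ⊆ {ω : Set ι | ∀ i ∈ T₂, i ∉ ω} := by
  intro θ hθ i hi2 hiθ
  have hc := coe_mem_active (V := V) (Q := Q) (j := j) hA
  set θ' : Set ι := (θ ∩ ↑T₂) ∪ ↑T₁ with hθ'
  have hdet : ∀ y, y ∉ T₂ → ∀ ω, insert y ω ∈ Q j ↔ ω ∈ Q j := by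
    intro y hy ω
    by_cases hyS : y ∈ S
    · rcases hcov y hyS with hy1 | hy2
      · exact hfree y hy1 ω
      · exact absurd hy2 hy
    · exact h.freeQ j hj y hyS ω
  have heq : θ' ∩ ↑T₂ = θ ∩ ↑T₂ := by
    ext k
    simp only [hθ', Set.mem_inter_iff, Set.mem_union, mem_coe]
    constructor
    · rintro ⟨h1 | h1, h2⟩
      · exact ⟨h1.1, h2⟩
      · exact absurd h2 (disjoint_left.1 hdisj h1)
    · rintro ⟨h1, h2⟩
      exact ⟨Or.inl ⟨h1, h2⟩, h2⟩
  have hθ'Q : θ' ∈ Q j := (mem_iff_of_inter_eq hdet heq).2 hθ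
  have hθ'V : θ' ∈ V j := h.up j hj Set.subset_union_right hc.1
  have := ((hA θ').1 ⟨hθ'V, hθ'Q⟩ i (hT₂ hi2)).1 (Or.inl ⟨hiθ, mem_coe.2 hi2⟩)
  exact disjoint_left.1 hdisj this hi2

end OneSided

/-! ### The contradiction -/

/-- **STEP m = 2 of THEOREM R*: the terminal two-voter configuration is impossible.** [this work] -/
theorem Good.absurd_two {j₁ j₂ : κ} (h : Good S {j₁, j₂} V₀ V Q) (hne : j₁ ≠ j₂) {T₁ T₂ : Finset ι}
    (hcov : ∀ i ∈ S, i ∈ T₁ ∨ i ∈ T₂) (hdisj : Disjoint T₁ T₂) (hT₁ : T₁ ⊆ S) (hT₂ : T₂ ⊆ S)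
    (hA1 : ∀ ω, ω ∈ V j₁ ∩ Q j₁ ↔ ∀ x ∈ S, (x ∈ ω ↔ x ∈ T₁))
    (hA2 : ∀ ω, ω ∈ V j₂ ∩ Q j₂ ↔ ∀ x ∈ S, (x ∈ ω ↔ x ∈ T₂))
    (hV1 : V j₁ ∩ Q j₁ ⊆ V₀) (hV2 : V j₂ ∩ Q j₂ ⊆ V₀)
    (hF1 : ∀ x ∈ T₂, ∀ y ∈ T₂, y ≠ x → ∀ ω : Set ι, x ∉ ω → (insert y ω ∈ V₀ ↔ ω ∈ V₀))
    (hF2 : ∀ x ∈ T₁, ∀ y ∈ T₁, y ≠ x → ∀ ω : Set ι, x ∉ ω → (insert y ω ∈ V₀ ↔ ω ∈ V₀))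
    (hne1 : T₁.Nonempty) (hne2 : T₂.Nonempty) : False := by
  have hj₁ : j₁ ∈ ({j₁, j₂} : Finset κ) := by simp
  have hj₂ : j₂ ∈ ({j₁, j₂} : Finset κ) := by simp
  have hcov' : ∀ i ∈ S, i ∈ T₂ ∨ i ∈ T₁ := fun i hi => (hcov i hi).symm
  have hc1 : (↑T₁ : Set ι) ∈ V j₁ ∩ Q j₁ := coe_mem_active hA1
  have hc2 : (↑T₂ : Set ι) ∈ V j₂ ∩ Q j₂ := coe_mem_active hA2
  have hact1 : (V j₁ ∩ Q j₁).Nonempty := ⟨_, hc1⟩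
  -- `∅ ∉ V₀`
  have h0 : (∅ : Set ι) ∉ V₀ := fun h0 => h.absurd_of_empty_mem hne hact1 (h.sub j₂ hj₂ h0)
  -- every live coordinate is essential for `V₀`
  have hess : ∀ x ∈ S, ¬ Ignores x (ind V₀) := by
    intro x hxS
    rcases hcov x hxS with hx1 | hx2
    · exact not_ignores_target h hcov hdisj hA1 hV1 hF1 hF2 h0 hne2 hx1
    · exact not_ignores_target h hcov' hdisj.symm hA2 hV2 hF2 hF1 h0 hne1 hx2
  -- degrees: at each live coordinate one of `Q_{j₁}, Q_{j₂}` is free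
  have hgi := GI.pair hne h.gi
  have hdeg : ∀ x ∈ S, Ignores x (ind (Q j₁)) ∨ Ignores x (ind (Q j₂)) := by
    intro x hxS
    by_contra hno
    push Not at hno
    have hV₀ne : V₀.Nonempty := ⟨_, hV1 hc1⟩
    have hQ1 := exPoly_ind_ne_zero (h.ne j₁ hj₁)
    have hQ2 := exPoly_ind_ne_zero (h.ne j₂ hj₂)
    have hR : degreeOf x (exPoly (ind V₀) * (exPoly (ind (Q j₁)) * exPoly (ind (Q j₂)))) = 3 := by
      rw [degreeOf_mul_eq (exPoly_ind_ne_zero hV₀ne) (mul_ne_zero hQ1 hQ2), degreeOf_mul_eq hQ1 hQ2,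
        degreeOf_exPoly_eq_one_of_not_ignores (hess x hxS), degreeOf_exPoly_eq_one_of_not_ignores hno.1,
        degreeOf_exPoly_eq_one_of_not_ignores hno.2]
    have hL : degreeOf x (exPoly (ind (V j₁ ∩ Q j₁)) * exPoly (ind (Q j₂)) +
        exPoly (ind (V j₂ ∩ Q j₂)) * exPoly (ind (Q j₁))) ≤ 2 := by
      refine (degreeOf_add_le x _ _).trans (max_le ?_ ?_) <;>
        exact (degreeOf_mul_le x _ _).trans (Nat.add_le_add (degreeOf_exPoly_le _ x) (degreeOf_exPoly_le _ x))
    rw [hgi, hR] at hL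
    omega
  -- `Q_{j₁}` is free on `T₁`, `Q_{j₂}` on `T₂`
  have hfreeQ1 : ∀ x ∈ T₁, ∀ ω, insert x ω ∈ Q j₁ ↔ ω ∈ Q j₁ := by
    intro x hx1
    refine forall_iff_of_ignores ((hdeg x (hT₁ hx1)).resolve_right fun hig => ?_)
    have hins : insert x (↑T₂ : Set ι) ∈ V j₂ ∩ Q j₂ :=
      ⟨h.up j₂ hj₂ (Set.subset_insert _ _) hc2.1, (forall_iff_of_ignores hig _).2 hc2.2⟩
    have := ((hA2 _).1 hins x (hT₁ hx1)).1 (Set.mem_insert _ _)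
    exact disjoint_left.1 hdisj hx1 this
  have hfreeQ2 : ∀ x ∈ T₂, ∀ ω, insert x ω ∈ Q j₂ ↔ ω ∈ Q j₂ := by
    intro x hx2
    refine forall_iff_of_ignores ((hdeg x (hT₂ hx2)).resolve_left fun hig => ?_)
    have hins : insert x (↑T₁ : Set ι) ∈ V j₁ ∩ Q j₁ :=
      ⟨h.up j₁ hj₁ (Set.subset_insert _ _) hc1.1, (forall_iff_of_ignores hig _).2 hc1.2⟩
    have := ((hA1 _).1 hins x (hT₂ hx2)).1 (Set.mem_insert _ _)
    exact disjoint_left.1 hdisj this hx2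
  -- the cylinder structure
  set Up₁ : Set (Set ι) := {ω | (↑T₁ : Set ι) ⊆ ω} with hUp₁
  set Up₂ : Set (Set ι) := {ω | (↑T₂ : Set ι) ⊆ ω} with hUp₂
  set Z₁ : Set (Set ι) := {ω | ∀ i ∈ T₂, i ∉ ω} with hZ₁
  set Z₂ : Set (Set ι) := {ω | ∀ i ∈ T₁, i ∉ ω} with hZ₂
  have hQZ1 : Q j₁ ⊆ Z₁ := subset_avoid h hj₁ hcov hdisj hT₂ hA1 hfreeQ1
  have hQZ2 : Q j₂ ⊆ Z₂ := subset_avoid h hj₂ hcov' hdisj.symm hT₁ hA2 hfreeQ2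
  have hA1eq : V j₁ ∩ Q j₁ = Up₁ ∩ Z₁ := active_eq_cyl hdisj hcov hT₁ hT₂ hA1
  have hA2eq : V j₂ ∩ Q j₂ = Up₂ ∩ Z₂ := active_eq_cyl hdisj.symm hcov' hT₂ hT₁ hA2
  -- `V₀ ⊆ Up₁ ∪ Up₂`
  have hV₀sub : V₀ ⊆ Up₁ ∪ Up₂ := by
    intro ω hω
    by_cases hS : (↑S : Set ι) ⊆ ω
    · exact Or.inl ((coe_subset.2 hT₁).trans hS)
    · obtain ⟨x, hxS, hxω⟩ := Set.not_subset.1 hS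
      rcases hcov x (mem_coe.1 hxS) with hx1 | hx2
      · exact Or.inr (supset_of_mem h hcov' hF2 hF1 h0 hx1 hxω hω)
      · exact Or.inl (supset_of_mem h hcov hF1 hF2 h0 hx2 hxω hω)
  -- measure computation at `p ≡ 1/2`
  have hc : (1 / 2 : ℝ) ∈ Set.Ioo (0 : ℝ) 1 := ⟨by norm_num, by norm_num⟩
  set p : ι → unitInterval := cst ι hc with hp
  have hpi : ∀ i, (p i : ℝ) ∈ Set.Ioo (0 : ℝ) 1 := cst_mem_Ioo hc
  have hev := congrArg (MvPolynomial.eval fun i => (p i : ℝ)) hgi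
  have hw : weight (fun i => (p i : ℝ)) = bernoulliWeight p := rfl
  simp only [map_add, map_mul, eval_exPoly, hw, ex_bernoulliWeight_ind] at hev
  rw [hA1eq, hA2eq, real_supset_inter_avoid p hdisj, real_supset_inter_avoid p hdisj.symm] at hev
  set P : Set (Set ι) → ℝ := fun A => (prodBernoulli p).real A with hP
  have hq1 : 0 < (prodBernoulli p).real (Q j₁) := real_pos_of_nonempty hpi (h.ne j₁ hj₁)
  have hq2 : 0 < (prodBernoulli p).real (Q j₂) := real_pos_of_nonempty hpi (h.ne j₂ hj₂)
  have hu1 : 0 ≤ (prodBernoulli p).real Up₁ := measureReal_nonneg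
  have hu2 : 0 ≤ (prodBernoulli p).real Up₂ := measureReal_nonneg
  have hz1 : (prodBernoulli p).real (Q j₁) ≤ (prodBernoulli p).real Z₁ := measureReal_mono hQZ1
  have hz2 : (prodBernoulli p).real (Q j₂) ≤ (prodBernoulli p).real Z₂ := measureReal_mono hQZ2
  have hUU : 0 < (prodBernoulli p).real (Up₁ ∩ Up₂) :=
    real_pos_of_nonempty hpi ⟨Set.univ, ⟨Set.subset_univ _, Set.subset_univ _⟩⟩
  have hunion : (prodBernoulli p).real (Up₁ ∪ Up₂) + (prodBernoulli p).real (Up₁ ∩ Up₂) =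
      (prodBernoulli p).real Up₁ + (prodBernoulli p).real Up₂ :=
    measureReal_union_add_inter MeasurableSet.of_discrete
  have hVle : (prodBernoulli p).real V₀ ≤ (prodBernoulli p).real (Up₁ ∪ Up₂) := measureReal_mono hV₀sub
  -- `(u₁ + u₂) q₁ q₂ ≤ u₁ z₁ q₂ + u₂ z₂ q₁ = v q₁ q₂`
  have e1 : (prodBernoulli p).real Up₁ * (prodBernoulli p).real (Q j₁) * (prodBernoulli p).real (Q j₂) ≤
      (prodBernoulli p).real Up₁ * (prodBernoulli p).real Z₁ * (prodBernoulli p).real (Q j₂) :=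
    mul_le_mul_of_nonneg_right (mul_le_mul_of_nonneg_left hz1 hu1) hq2.le
  have e2 : (prodBernoulli p).real Up₂ * (prodBernoulli p).real (Q j₂) * (prodBernoulli p).real (Q j₁) ≤
      (prodBernoulli p).real Up₂ * (prodBernoulli p).real Z₂ * (prodBernoulli p).real (Q j₁) :=
    mul_le_mul_of_nonneg_right (mul_le_mul_of_nonneg_left hz2 hu2) hq1.le
  have hsum : ((prodBernoulli p).real Up₁ + (prodBernoulli p).real Up₂) *
      ((prodBernoulli p).real (Q j₁) * (prodBernoulli p).real (Q j₂)) ≤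
      (prodBernoulli p).real V₀ * ((prodBernoulli p).real (Q j₁) * (prodBernoulli p).real (Q j₂)) := by
    rw [← hev]
    nlinarith [e1, e2]
  have hle : (prodBernoulli p).real Up₁ + (prodBernoulli p).real Up₂ ≤ (prodBernoulli p).real V₀ :=
    le_of_mul_le_mul_right hsum (mul_pos hq1 hq2)
  linarith

end RigidityAll

end Summit.CriticalPhenomena.PercolationContinuityZ3.Theorems
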